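import Summits.NavierStokesRegularity.NavierStokesRegularity.Theorems.ExtremiserTransienceRegularisedNearPlateauStabilityBangBangCoreDensitySupBound
import Summits.NavierStokesRegularity.NavierStokesRegularity.Theorems.ExtremiserTransienceBangBangCoreDefs
import HarnessLib

/-!
# Route `ExtremiserTransience`, crux `RegularisedNearPlateauStability` (stmt-NavierStokesRegularity-28317),
# LINE g6-γ «bang-bang core»: registered stub K2 `stub_densitySupBound` BY NAME AND SIGNATURE

`--supports stmt-NavierStokesRegularity-28317`. Author: prover seat `ns-net-p2` (g0).

The registered stub, stated verbatim over the line's vocabulary (`…Theorems.DepletionLadder.KStar.BangBang.{lam, ell, IsAdm,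
IsReg, IsDensity}`, file `ExtremiserTransienceBangBangCoreDefs`, = the skeleton's `BangBangCore` §0 abbreviations), and
proved by the unfolded theorem `BangBang.densitySupBound` (file `…BangBangCoreDensitySupBound`): for every budget `A ≥ 1`
there is `C_G > 0` such that every admissible `A`-regular non-degenerate field admits an Euler–Lagrange density `G` with
`‖G(x)‖ ≤ C_G·M³·W·λ⁻³`. The skeleton's own copy closes the same way (`exact BangBang.densitySupBound`, definitional unfolding).
HONEST FRAMING: an estimate on an explicit differential expression; nothing about Navier–Stokes is proved; no summit is
proved by a line. [folklore]
-/

noncomputable section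

open scoped InnerProductSpace RealInnerProductSpace ENNReal ContDiff
open Literature.Analysis.FluidPDE
open Summit.NavierStokesRegularity.NavierStokesRegularity.Theorems.DepletionLadder.KStar.HalfSpace

namespace Summit.NavierStokesRegularity.NavierStokesRegularity.Theorems

-- the problem directory repeats the summit name (`NavierStokesRegularity/NavierStokesRegularity`)
set_option linter.dupNamespace false

namespace DepletionLadder.KStar.BangBang

/-- **K2 — DENSITY SUP BOUND** (registered stub of LINE `bangbang_core`, by name and signature): in the A-regular class the
Euler–Lagrange density of the first variation `ell` is bounded by `C_G(A)·M³·W·λ⁻³` (`BangBang.densitySupBound`). [folklore] -/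
theorem stub_densitySupBound :
    ∀ A : ℕ → ℝ, (∀ j, 1 ≤ A j) → ∃ C_G : ℝ, 0 < C_G ∧ ∀ (v : E3 → E3) (M B : ℝ), IsAdm v M B → IsReg A v M →
      0 < M * Real.sqrt (Zen v) * Real.sqrt (Wpa v) →
        ∃ G : E3 → E3, IsDensity v M G ∧ ∀ x, ‖G x‖ ≤ C_G * M ^ 3 * Wpa v * (lam v)⁻¹ ^ 3 :=
  densitySupBound

end DepletionLadder.KStar.BangBang

end Summit.NavierStokesRegularity.NavierStokesRegularity.Theorems

end
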